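import Summits.CriticalPhenomena.Ising3D.IsingColumnFaceL11CensusSegmentTrgA
import Summits.CriticalPhenomena.Ising3D.IsingColumnFaceL11CensusSegmentTrgB
import Summits.CriticalPhenomena.Ising3D.IsingColumnFaceL11CensusSegmentTrgC

/-!
# The `TRG` census of §7.3 on the certified `Δε` segment as kernel facts, V: the `Γ(⅓)^b`, `b = 1, 2, 3`
classes and the theorems (cell `pub-ising3x`, seat recog-1; paper §7.1 / §7.3)

HONEST FRAMING: lottery ticket; floor = tightest certified 3D Ising CFT bounds; no exact-solution
claim without a proof. Island framing: certified exclusion region at stated derivative order and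
assumptions; not a determination of the 3D Ising critical exponents beyond that.

The last three kernel evaluations of the machine of `IsingColumnFaceL11CensusSegmentTrg.lean` (≈ 100 s of
kernel time) and the ASSEMBLY of all fifteen (`…SegmentTrgA/B/C.lean`):
* `trgSeg_checked`, `trgSegAll_decided` (no tuple of the table has an enclosure straddling a cut point),
  `trgSegAll_nodup`;
* `trg_tuple_subwindow_iff` / `trg_tuple_segment_iff`, `exists_canon_of_mem_trgFullFamily` (every member is
  the value of a canonical tuple), the real-number form `trg_mem_subwindow_iff` (a real number is a
  `trgFullFamily 17 32` member in sub-window `k` iff it is the value of a bin-`k` candidate: the COMPLETE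
  census), `trg_descr_ncard`;
* **`trg_descr_subwindow_ncard`: §7.3's «10 948 / 15 320 / 13 071» are kernel facts** — exactly that many
  canonical lowest-terms descriptions of `TRG` take their value in `[81/64, 13/10]` / `[13/10, 27/20]` /
  `[27/20, 2855/2048]`; `trg_descr_segment_ncard`: 39 339 on the whole segment; `trg_examples_binned`
  (`(3/4)√π`, `(7/9)√π` where §7.3 puts them).
A statement about the frozen catalogue's density on the certified segment, NOT about `Δε`; nothing is
recognised; no P(M·) relevance. Pure arithmetic over landed definitions and certified enclosures; no
certificate, no datum, no σ–ε axiom.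
lottery ticket; floor = tightest certified 3D Ising CFT bounds; no exact-solution claim without a proof.
-/

namespace Summit.CriticalPhenomena.Ising3D
namespace ColumnFaceL11
open Set Literature.MathematicalPhysics.QuantumFieldTheory.ConformalBootstrap3D

/-- `Γ`-class `(1, 1)` (`Γ(⅓)^{1}`): all candidates decided, codes increasing, `981 / 1367 / 1157`
lowest-terms candidates in the three sub-window bins. [folklore] -/
theorem trgSegCheck_1_1 : trgSegCheck 1 1 981 1367 1157 = true := by
  decide +kernel

/-- `Γ`-class `(1, 2)` (`Γ(⅓)^{2}`): all candidates decided, codes increasing, `922 / 1255 / 1094`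
lowest-terms candidates in the three sub-window bins. [folklore] -/
theorem trgSegCheck_1_2 : trgSegCheck 1 2 922 1255 1094 = true := by
  decide +kernel

/-- `Γ`-class `(1, 3)` (`Γ(⅓)^{3}`): all candidates decided, codes increasing, `716 / 1026 / 921`
lowest-terms candidates in the three sub-window bins. [folklore] -/
theorem trgSegCheck_1_3 : trgSegCheck 1 3 716 1026 921 = true := by
  decide +kernel

/-! ### All fifteen parts are checked -/

/-- The fifteen part checks, with their counts. [folklore] -/
theorem trgSeg_checked : ∀ gb ∈ trgGBList, ∃ n0 n1 n2, trgSegCheck gb.1 gb.2 n0 n1 n2 = true := by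
  intro gb hgb
  simp only [trgGBList, List.mem_cons, List.not_mem_nil, or_false] at hgb
  rcases hgb with rfl|rfl|rfl|rfl|rfl|rfl|rfl|rfl|rfl|rfl|rfl|rfl|rfl|rfl|rfl
  · exact ⟨_, _, _, trgSegCheck_0_m4⟩
  · exact ⟨_, _, _, trgSegCheck_0_m3⟩
  · exact ⟨_, _, _, trgSegCheck_0_m2⟩
  · exact ⟨_, _, _, trgSegCheck_0_m1⟩
  · exact ⟨_, _, _, trgSegCheck_0_0⟩
  · exact ⟨_, _, _, trgSegCheck_0_1⟩
  · exact ⟨_, _, _, trgSegCheck_0_2⟩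
  · exact ⟨_, _, _, trgSegCheck_0_3⟩
  · exact ⟨_, _, _, trgSegCheck_0_4⟩
  · exact ⟨_, _, _, trgSegCheck_1_m3⟩
  · exact ⟨_, _, _, trgSegCheck_1_m2⟩
  · exact ⟨_, _, _, trgSegCheck_1_m1⟩
  · exact ⟨_, _, _, trgSegCheck_1_1⟩
  · exact ⟨_, _, _, trgSegCheck_1_2⟩
  · exact ⟨_, _, _, trgSegCheck_1_3⟩

/-- Every candidate is decided (bin `≤ 3`). [folklore] -/
theorem trgSegAll_decided {be : (ℕ × Bool) × TrgTuple} (hbe : be ∈ trgSegAll) : be.1.1 ≤ 3 := by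
  obtain ⟨g, b, hgb, hbi⟩ := mem_trgSegAll_iff.mp hbe
  obtain ⟨n0, n1, n2, hc⟩ := trgSeg_checked (g, b) hgb
  exact (trgSegCheck_spec hc).1 be hbi

/-- The candidate tuples have no duplicates. [folklore] -/
theorem trgSegAll_nodup : (trgSegAll.map Prod.snd).Nodup :=
  nodup_trgSegAll_snd fun gb hgb => by
    obtain ⟨n0, n1, n2, hc⟩ := trgSeg_checked gb hgb
    exact (trgSegCheck_spec hc).2.1

/-- **The sub-window membership theorem.** For `k = 0, 1, 2`: a canonical tuple of the table
`trgFullFamily 17 32` has its value in the closed sub-window `[segCutQ k, segCutQ (k+1)]` iff it is a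
candidate of bin `k`. [folklore] -/
theorem trg_tuple_subwindow_iff {k : ℕ} (hk : k < 3) (e : TrgTuple) :
    (trgGTupleOK 17 32 e = true ∧ trgCanon e = true ∧ ((segCutQ k : ℚ) : ℝ) ≤ trgGTupleVal e ∧
        trgGTupleVal e ≤ ((segCutQ (k + 1) : ℚ) : ℝ)) ↔ ((k, trgPrim e), e) ∈ trgSegAll := by
  have hc01 : ((segCutQ 0 : ℚ) : ℝ) < ((segCutQ 1 : ℚ) : ℝ) := by norm_num [segCutQ]
  have hc12 : ((segCutQ 1 : ℚ) : ℝ) < ((segCutQ 2 : ℚ) : ℝ) := by norm_num [segCutQ]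
  have hc23 : ((segCutQ 2 : ℚ) : ℝ) < ((segCutQ 3 : ℚ) : ℝ) := by norm_num [segCutQ]
  obtain ⟨p, q, u, a, g, b, L, s⟩ := e
  obtain ⟨h1, h2⟩ := trgGTupleVal_mem_encl p q u a g b L s
  obtain ⟨s0, s1, s2, s3⟩ := trgBin_spec h1 h2
  have hbdef : trgBinOf (p, q, u, a, g, b, L, s) = trgBin (p : ℤ) q (trgEnclR u a g b L s) := rfl
  rw [← hbdef] at s0 s1 s2 s3
  constructor
  · rintro ⟨hok, hcan, hlo, hhi⟩
    have hlo0 : ((segCutQ 0 : ℚ) : ℝ) ≤ trgGTupleVal (p, q, u, a, g, b, L, s) := by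
      interval_cases k
      · exact hlo
      · exact hc01.le.trans hlo
      · exact (hc01.le.trans hc12.le).trans hlo
    have hhi3 : trgGTupleVal (p, q, u, a, g, b, L, s) ≤ ((segCutQ 3 : ℚ) : ℝ) := by
      interval_cases k
      · exact hhi.trans (hc12.le.trans hc23.le)
      · exact hhi.trans hc23.le
      · exact hhi
    have hmem := mem_trgSegAll_of_mem_segment hok hcan hlo0 hhi3
    have hdec : trgBinOf (p, q, u, a, g, b, L, s) ≤ 3 := trgSegAll_decided hmem
    have hb : trgBinOf (p, q, u, a, g, b, L, s) = k := by
      interval_cases k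
      · interval_cases hb : trgBinOf (p, q, u, a, g, b, L, s)
        · rfl
        · linarith [(s1 rfl).1]
        · linarith [(s2 rfl).1]
        · rcases s3 rfl with h3 | h3 <;> linarith
      · interval_cases hb : trgBinOf (p, q, u, a, g, b, L, s)
        · linarith [(s0 rfl).2]
        · rfl
        · linarith [(s2 rfl).1]
        · rcases s3 rfl with h3 | h3 <;> linarith
      · interval_cases hb : trgBinOf (p, q, u, a, g, b, L, s)
        · linarith [(s0 rfl).2]
        · linarith [(s1 rfl).2]
        · rfl
        · rcases s3 rfl with h3 | h3 <;> linarith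
    rw [hb] at hmem
    exact hmem
  · intro hmem
    obtain ⟨hgb, hpart⟩ := trgSegAll_class hmem
    obtain ⟨hshape, hok, hcan, -, -⟩ := trgSegAll_shape hgb hpart
    have hb : trgBinOf (p, q, u, a, g, b, L, s) = k := by
      have := congrArg (fun t : (ℕ × Bool) × TrgTuple => t.1.1) hshape
      simpa using this.symm
    refine ⟨hok, hcan, ?_⟩
    interval_cases k
    · exact ⟨(s0 hb).1, (s0 hb).2.le⟩
    · exact ⟨(s1 hb).1.le, (s1 hb).2.le⟩
    · exact ⟨(s2 hb).1.le, (s2 hb).2⟩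

/-- **The segment membership theorem.** A canonical tuple of the table has its value in the certified
segment `[81/64, 2855/2048]` iff it is a candidate of bin `≤ 2`. [folklore] -/
theorem trg_tuple_segment_iff (e : TrgTuple) :
    (trgGTupleOK 17 32 e = true ∧ trgCanon e = true ∧ ((segCutQ 0 : ℚ) : ℝ) ≤ trgGTupleVal e ∧
        trgGTupleVal e ≤ ((segCutQ 3 : ℚ) : ℝ)) ↔ (((trgBinOf e, trgPrim e), e) ∈ trgSegAll ∧ trgBinOf e ≤ 2) := by
  have hc01 : ((segCutQ 0 : ℚ) : ℝ) < ((segCutQ 1 : ℚ) : ℝ) := by norm_num [segCutQ]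
  have hc12 : ((segCutQ 1 : ℚ) : ℝ) < ((segCutQ 2 : ℚ) : ℝ) := by norm_num [segCutQ]
  have hc23 : ((segCutQ 2 : ℚ) : ℝ) < ((segCutQ 3 : ℚ) : ℝ) := by norm_num [segCutQ]
  obtain ⟨p, q, u, a, g, b, L, s⟩ := e
  obtain ⟨h1, h2⟩ := trgGTupleVal_mem_encl p q u a g b L s
  obtain ⟨s0, s1, s2, s3⟩ := trgBin_spec h1 h2
  have hbdef : trgBinOf (p, q, u, a, g, b, L, s) = trgBin (p : ℤ) q (trgEnclR u a g b L s) := rfl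
  rw [← hbdef] at s0 s1 s2 s3
  constructor
  · rintro ⟨hok, hcan, hlo, hhi⟩
    have hmem := mem_trgSegAll_of_mem_segment hok hcan hlo hhi
    have hdec : trgBinOf (p, q, u, a, g, b, L, s) ≤ 3 := trgSegAll_decided hmem
    refine ⟨hmem, ?_⟩
    by_contra hne
    have h3 : trgBinOf (p, q, u, a, g, b, L, s) = 3 := by omega
    rcases s3 h3 with h3 | h3 <;> linarith
  · rintro ⟨hmem, hb⟩
    obtain ⟨hgb, hpart⟩ := trgSegAll_class hmem
    obtain ⟨-, hok, hcan, -, -⟩ := trgSegAll_shape hgb hpart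
    refine ⟨hok, hcan, ?_⟩
    interval_cases hbk : trgBinOf (p, q, u, a, g, b, L, s)
    · exact ⟨(s0 rfl).1, (s0 rfl).2.le.trans (hc12.le.trans hc23.le)⟩
    · exact ⟨hc01.le.trans (s1 rfl).1.le, (s1 rfl).2.le.trans hc23.le⟩
    · exact ⟨(hc01.le.trans hc12.le).trans (s2 rfl).1.le, (s2 rfl).2⟩

/-- Every member of `trgFullFamily 17 32` is the value of a CANONICAL tuple of the table (normalise `L`
when `s = 0` and `g` when `b = 0`, as in `trgFullExcluded_sound`). [folklore] -/
theorem exists_canon_of_mem_trgFullFamily {x : ℝ} (hx : x ∈ trgFullFamily 17 32) :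
    ∃ e : TrgTuple, trgGTupleOK 17 32 e = true ∧ trgCanon e = true ∧ x = trgGTupleVal e := by
  obtain ⟨p, q, u, L₀, g₀, av, b, s, hp1, hph, hq1, hqh, hu, hL₀, hg₀, ha1, ha2, hb1, hb2, hs1, hs2, hne, hD, rfl⟩ :=
    hx
  obtain ⟨L, hL, hskip, hvalL⟩ : ∃ L, L ≤ 4 ∧ ¬(s = 0 ∧ 0 < L) ∧
      trgGVal u av g₀ b L₀ s = trgGVal u av g₀ b L s := by
    by_cases hs : s = 0
    · exact ⟨0, by omega, by omega, by simp [trgGVal, trgLVal, hs]⟩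
    · exact ⟨L₀, hL₀, by omega, rfl⟩
  obtain ⟨g, hg, hgb, hvalG⟩ : ∃ g : ℕ, g ≤ 1 ∧ ¬(b = 0 ∧ g = 1) ∧ (-(4 - (g : ℤ)) ≤ b ∧ b ≤ 4 - (g : ℤ)) ∧
      trgGVal u av g₀ b L s = trgGVal u av g b L s := by
    by_cases hb : b = 0
    · exact ⟨0, by omega, by omega, by omega, by simp [trgGVal, hb]⟩
    · exact ⟨g₀, hg₀, by omega, ⟨hb1, hb2⟩, rfl⟩
  refine ⟨(p, q, u, av, g, b, L, s), ?_, ?_, ?_⟩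
  · simp only [trgGTupleOK, Bool.and_eq_true, decide_eq_true_eq]
    exact ⟨⟨⟨⟨⟨⟨⟨⟨⟨⟨⟨⟨⟨⟨hp1, hph⟩, hq1⟩, hqh⟩, hu⟩, hL⟩, hg⟩, ha1⟩, ha2⟩, hvalG.1.1⟩, hvalG.1.2⟩, hs1⟩, hs2⟩,
      hne⟩, hD⟩
  · simp only [trgCanon, Bool.and_eq_true, Bool.not_eq_true', decide_eq_false_iff_not]
    exact ⟨hskip, hgb⟩
  · unfold trgGTupleVal
    simp only
    rw [hvalL, hvalG.2]

/-- **Real-number form.** For `k = 0, 1, 2`: a real number is a member of `trgFullFamily 17 32` lying in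
the closed sub-window `k` iff it is the value of a candidate tuple of bin `k`. [folklore] -/
theorem trg_mem_subwindow_iff {k : ℕ} (hk : k < 3) (x : ℝ) :
    (x ∈ trgFullFamily 17 32 ∧ ((segCutQ k : ℚ) : ℝ) ≤ x ∧ x ≤ ((segCutQ (k + 1) : ℚ) : ℝ)) ↔
      ∃ be ∈ trgSegAll, be.1.1 = k ∧ x = trgGTupleVal be.2 := by
  constructor
  · rintro ⟨hx, hlo, hhi⟩
    obtain ⟨e, hok, hcan, rfl⟩ := exists_canon_of_mem_trgFullFamily hx
    have hmem := (trg_tuple_subwindow_iff hk e).mp ⟨hok, hcan, hlo, hhi⟩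
    exact ⟨_, hmem, rfl, rfl⟩
  · rintro ⟨be, hbe, hb, rfl⟩
    obtain ⟨hgb, hpart⟩ := trgSegAll_class hbe
    obtain ⟨hshape, -, -, -, -⟩ := trgSegAll_shape hgb hpart
    have hbin : trgBinOf be.2 = k := by
      have hb' := hb; rw [hshape] at hb'; simpa using hb'
    have hmem : ((k, trgPrim be.2), be.2) ∈ trgSegAll := by
      rw [← hbin]; rw [hshape] at hbe; exact hbe
    obtain ⟨hok', -, hlo, hhi⟩ := (trg_tuple_subwindow_iff hk be.2).mpr hmem
    exact ⟨mem_trgFullFamily_of_trgGTupleOK hok', hlo, hhi⟩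

/-- **Counting.** For `k = 0, 1, 2`: the number of canonical lowest-terms descriptions of the table
`trgFullFamily 17 32` with value in the closed sub-window `k` equals the kernel's count of lowest-terms
candidates of bin `k`. [folklore] -/
theorem trg_descr_ncard {k : ℕ} (hk : k < 3) :
    {e : TrgTuple | trgGTupleOK 17 32 e = true ∧ trgCanon e = true ∧ trgPrim e = true ∧
        ((segCutQ k : ℚ) : ℝ) ≤ trgGTupleVal e ∧ trgGTupleVal e ≤ ((segCutQ (k + 1) : ℚ) : ℝ)}.ncard =
      trgSegAll.countP (fun be => be.1.1 == k && be.1.2) := by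
  classical
  set M := (trgSegAll.filter fun be => be.1.1 == k && be.1.2).map Prod.snd with hM
  have hiff : ∀ e, e ∈ {e : TrgTuple | trgGTupleOK 17 32 e = true ∧ trgCanon e = true ∧ trgPrim e = true ∧
      ((segCutQ k : ℚ) : ℝ) ≤ trgGTupleVal e ∧ trgGTupleVal e ≤ ((segCutQ (k + 1) : ℚ) : ℝ)} ↔ e ∈ M := by
    intro e
    rw [hM, List.mem_map]
    simp only [Set.mem_setOf_eq, List.mem_filter, Bool.and_eq_true, beq_iff_eq]
    constructor
    · rintro ⟨hok, hcan, hprim, hlo, hhi⟩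
      have hmem := (trg_tuple_subwindow_iff hk e).mp ⟨hok, hcan, hlo, hhi⟩
      rw [hprim] at hmem
      exact ⟨_, ⟨hmem, rfl, rfl⟩, rfl⟩
    · rintro ⟨be, ⟨hbe, hb, hp⟩, rfl⟩
      obtain ⟨hgb, hpart⟩ := trgSegAll_class hbe
      obtain ⟨hshape, -, -, -, -⟩ := trgSegAll_shape hgb hpart
      have hprim : trgPrim be.2 = true := by
        have hp' := hp; rw [hshape] at hp'; simpa using hp'
      have hbin : trgBinOf be.2 = k := by
        have hb' := hb; rw [hshape] at hb'; simpa using hb'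
      have hmem : ((k, trgPrim be.2), be.2) ∈ trgSegAll := by
        rw [← hbin]; rw [hshape] at hbe; exact hbe
      obtain ⟨hok, hcan, hlo, hhi⟩ := (trg_tuple_subwindow_iff hk be.2).mpr hmem
      exact ⟨hok, hcan, hprim, hlo, hhi⟩
  have hnd : M.Nodup := by
    rw [hM]
    exact trgSegAll_nodup.sublist (List.filter_sublist.map Prod.snd)
  rw [set_ncard_eq_length_of_iff hnd hiff, hM, List.length_map, List.countP_eq_length_filter]

/-- **Counting on the whole segment** (as a candidate count). [folklore] -/
theorem trg_descr_segment_ncard_countP :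
    {e : TrgTuple | trgGTupleOK 17 32 e = true ∧ trgCanon e = true ∧ trgPrim e = true ∧
        ((segCutQ 0 : ℚ) : ℝ) ≤ trgGTupleVal e ∧ trgGTupleVal e ≤ ((segCutQ 3 : ℚ) : ℝ)}.ncard =
      trgSegAll.countP (fun be => decide (be.1.1 ≤ 2) && be.1.2) := by
  classical
  set M := (trgSegAll.filter fun be => decide (be.1.1 ≤ 2) && be.1.2).map Prod.snd with hM
  have hiff : ∀ e, e ∈ {e : TrgTuple | trgGTupleOK 17 32 e = true ∧ trgCanon e = true ∧ trgPrim e = true ∧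
      ((segCutQ 0 : ℚ) : ℝ) ≤ trgGTupleVal e ∧ trgGTupleVal e ≤ ((segCutQ 3 : ℚ) : ℝ)} ↔ e ∈ M := by
    intro e
    rw [hM, List.mem_map]
    simp only [Set.mem_setOf_eq, List.mem_filter, Bool.and_eq_true, decide_eq_true_eq]
    constructor
    · rintro ⟨hok, hcan, hprim, hlo, hhi⟩
      obtain ⟨hmem, hb⟩ := (trg_tuple_segment_iff e).mp ⟨hok, hcan, hlo, hhi⟩
      rw [hprim] at hmem
      exact ⟨_, ⟨hmem, hb, rfl⟩, rfl⟩
    · rintro ⟨be, ⟨hbe, hb, hp⟩, rfl⟩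
      obtain ⟨hgb, hpart⟩ := trgSegAll_class hbe
      obtain ⟨hshape, -, -, -, -⟩ := trgSegAll_shape hgb hpart
      have hprim : trgPrim be.2 = true := by
        have hp' := hp; rw [hshape] at hp'; simpa using hp'
      have hbin : trgBinOf be.2 ≤ 2 := by
        have hb' := hb; rw [hshape] at hb'; simpa using hb'
      have hmem : ((trgBinOf be.2, trgPrim be.2), be.2) ∈ trgSegAll := by
        rw [hshape] at hbe; exact hbe
      obtain ⟨hok, hcan, hlo, hhi⟩ := (trg_tuple_segment_iff be.2).mpr ⟨hmem, hbin⟩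
      exact ⟨hok, hcan, hprim, hlo, hhi⟩
  have hnd : M.Nodup := by
    rw [hM]
    exact trgSegAll_nodup.sublist (List.filter_sublist.map Prod.snd)
  rw [set_ncard_eq_length_of_iff hnd hiff, hM, List.length_map, List.countP_eq_length_filter]

/-! ### The census numbers of §7.3 -/

/-- Splitting the «bin ≤ 2» count into the three bins. [folklore] -/
theorem trg_countP_bin_le_two (Lst : List ((ℕ × Bool) × TrgTuple)) :
    Lst.countP (fun be => decide (be.1.1 ≤ 2) && be.1.2) =
      Lst.countP (fun be => be.1.1 == 0 && be.1.2) + Lst.countP (fun be => be.1.1 == 1 && be.1.2) +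
        Lst.countP (fun be => be.1.1 == 2 && be.1.2) := by
  induction Lst with
  | nil => simp
  | cons be Lst ih =>
      obtain ⟨⟨bn, pr⟩, e⟩ := be
      simp only [List.countP_cons, ih]
      rcases Nat.lt_or_ge bn 3 with hb | hb
      · interval_cases bn <;> cases pr <;> simp <;> omega
      · have h0 : (bn == 0) = false := by rw [beq_eq_false_iff_ne]; omega
        have h1 : (bn == 1) = false := by rw [beq_eq_false_iff_ne]; omega
        have h2 : (bn == 2) = false := by rw [beq_eq_false_iff_ne]; omega
        have h3 : decide (bn ≤ 2) = false := by rw [decide_eq_false_iff_not]; omega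
        simp [h0, h1, h2, h3]

/-- The three lowest-terms bin counts of the whole candidate list: `10948 / 15320 / 13071`. [folklore] -/
theorem trgSegAll_counts :
    trgSegAll.countP (fun be => be.1.1 == 0 && be.1.2) = 10948 ∧
      trgSegAll.countP (fun be => be.1.1 == 1 && be.1.2) = 15320 ∧
      trgSegAll.countP (fun be => be.1.1 == 2 && be.1.2) = 13071 := by
  obtain ⟨-, -, a0, a1, a2⟩ := trgSegCheck_spec trgSegCheck_0_m4
  obtain ⟨-, -, b0, b1, b2⟩ := trgSegCheck_spec trgSegCheck_0_m3
  obtain ⟨-, -, c0, c1, c2⟩ := trgSegCheck_spec trgSegCheck_0_m2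
  obtain ⟨-, -, d0, d1, d2⟩ := trgSegCheck_spec trgSegCheck_0_m1
  obtain ⟨-, -, e0, e1, e2⟩ := trgSegCheck_spec trgSegCheck_0_0
  obtain ⟨-, -, f0, f1, f2⟩ := trgSegCheck_spec trgSegCheck_0_1
  obtain ⟨-, -, g0, g1, g2⟩ := trgSegCheck_spec trgSegCheck_0_2
  obtain ⟨-, -, h0, h1, h2⟩ := trgSegCheck_spec trgSegCheck_0_3
  obtain ⟨-, -, i0, i1, i2⟩ := trgSegCheck_spec trgSegCheck_0_4
  obtain ⟨-, -, j0, j1, j2⟩ := trgSegCheck_spec trgSegCheck_1_m3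
  obtain ⟨-, -, k0, k1, k2⟩ := trgSegCheck_spec trgSegCheck_1_m2
  obtain ⟨-, -, l0, l1, l2⟩ := trgSegCheck_spec trgSegCheck_1_m1
  obtain ⟨-, -, m0, m1, m2⟩ := trgSegCheck_spec trgSegCheck_1_1
  obtain ⟨-, -, n0, n1, n2⟩ := trgSegCheck_spec trgSegCheck_1_2
  obtain ⟨-, -, o0, o1, o2⟩ := trgSegCheck_spec trgSegCheck_1_3
  refine ⟨?_, ?_, ?_⟩
  · rw [countP_trgSegAll, a0, b0, c0, d0, e0, f0, g0, h0, i0, j0, k0, l0, m0, n0, o0]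
  · rw [countP_trgSegAll, a1, b1, c1, d1, e1, f1, g1, h1, i1, j1, k1, l1, m1, n1, o1]
  · rw [countP_trgSegAll, a2, b2, c2, d2, e2, f2, g2, h2, i2, j2, k2, l2, m2, n2, o2]

/-- **§7.3's `TRG` census numbers are kernel facts: 10 948 / 15 320 / 13 071.** The number of canonical
lowest-terms descriptions `(p, q, u, a, g, b, L, s)` of the frozen table `TRG` (`trgGTupleOK 17 32`: all
6 432 monomials `u·π^{a/2}·Γ_g^b·L^s`, `1 ≤ p, q ≤ 32`; `trgCanon`; `gcd(p, q) = 1`) whose value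
`(p/q)·u·π^{a/2}·Γ_g^b·L^s` lies in the closed sub-window `[81/64, 13/10]`, resp. `[13/10, 27/20]`, resp.
`[27/20, 2855/2048]`, is exactly `10948`, resp. `15320`, resp. `13071` (the recogniser's census of record
and the cell's further independent implementations print the same numbers; here the kernel decides every
membership by the certified enclosures). About the catalogue's density, NOT about `Δε`; nothing is
recognised. [folklore] -/
theorem trg_descr_subwindow_ncard :
    {e : TrgTuple | trgGTupleOK 17 32 e = true ∧ trgCanon e = true ∧ trgPrim e = true ∧
        ((segCutQ 0 : ℚ) : ℝ) ≤ trgGTupleVal e ∧ trgGTupleVal e ≤ ((segCutQ 1 : ℚ) : ℝ)}.ncard = 10948 ∧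
    {e : TrgTuple | trgGTupleOK 17 32 e = true ∧ trgCanon e = true ∧ trgPrim e = true ∧
        ((segCutQ 1 : ℚ) : ℝ) ≤ trgGTupleVal e ∧ trgGTupleVal e ≤ ((segCutQ 2 : ℚ) : ℝ)}.ncard = 15320 ∧
    {e : TrgTuple | trgGTupleOK 17 32 e = true ∧ trgCanon e = true ∧ trgPrim e = true ∧
        ((segCutQ 2 : ℚ) : ℝ) ≤ trgGTupleVal e ∧ trgGTupleVal e ≤ ((segCutQ 3 : ℚ) : ℝ)}.ncard = 13071 := by
  obtain ⟨h0, h1, h2⟩ := trgSegAll_counts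
  exact ⟨(trg_descr_ncard (k := 0) (by norm_num)).trans h0, (trg_descr_ncard (k := 1) (by norm_num)).trans h1,
    (trg_descr_ncard (k := 2) (by norm_num)).trans h2⟩

/-- **On the whole certified segment `[81/64, 2855/2048]`: exactly 39 339 canonical lowest-terms `TRG`
descriptions** (`= 10948 + 15320 + 13071`; no description takes the value `13/10` or `27/20`). [folklore] -/
theorem trg_descr_segment_ncard :
    {e : TrgTuple | trgGTupleOK 17 32 e = true ∧ trgCanon e = true ∧ trgPrim e = true ∧
        ((segCutQ 0 : ℚ) : ℝ) ≤ trgGTupleVal e ∧ trgGTupleVal e ≤ ((segCutQ 3 : ℚ) : ℝ)}.ncard = 39339 := by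
  obtain ⟨h0, h1, h2⟩ := trgSegAll_counts
  rw [trg_descr_segment_ncard_countP, trg_countP_bin_le_two, h0, h1, h2]

/-- **The simplest members sit where §7.3 says** (instances of the binning, by the same enclosures):
`(3/4)√π` (`p/q = 3/4`, `u = 1`, `a = 1`; bin `1`: in `[13/10, 27/20]`) and `(7/9)√π` (bin `2`: in
`[27/20, 2855/2048]`). [folklore] -/
theorem trg_examples_binned :
    trgBinOf (3, 4, 0, 1, 0, 0, 0, 0) = 1 ∧ trgBinOf (7, 9, 0, 1, 0, 0, 0, 0) = 2 := by
  constructor <;> decide +kernel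

end ColumnFaceL11
end Summit.CriticalPhenomena.Ising3D
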